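import Mathlib
import Summits.ValiantsHypothesis.ValiantsHypothesis.Statement
import Summits.ValiantsHypothesis.ValiantsHypothesis.Theorems.SoloInformedPolynomialSections
import Summits.ValiantsHypothesis.ValiantsHypothesis.Theorems.SoloInformedMultivariateWindow
import HarnessLib

/-!
# (Q*-poly) implies the summit: the window form with POLYNOMIAL sections on few variables
# (solo seat `solo-ValiantsHypothesis-informed`, s30)

Continuation of `SoloInformedPolynomialSections`.  With the Reed–Muller window designs of
`SoloInformedWindowDesign` / `SoloInformedMultivariateWindow` (independent to order `Kf s`,
`SoloIndep`) and the polynomial-sections form of Raz's Cor. 5.8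
(`soloInformed_vp_ne_vnp_of_polyWindow_pointwise`):

* `soloInformed_valiantsHypothesis_of_polyWindowBound_fewVars` (all `n`:
  `…_of_polyWindowBound`; log order `…LogOrderBound[_fewVars]`; fixed order
  `…FixedOrderBound[_fewVars]`; natural exponents `…_fewVars_exponent`) — for every order
  function `Kf s ≤ (⌊log₂ s⌋ + 2)^C` and every `c₀`,

  (Q*-poly)  for all large `s`: every set family `S_1, …, S_m ⊂ Fin n` with `n^{c₀} ≤ s`,
  independent to order `Kf s`, whose monomials `x^{S_i}` all lie in the linear span of the
  products `y_j y_k` of `s` POLYNOMIALS `y_1, …, y_s ∈ ℂ[x_1, …, x_n]`, has `m ≤ C · s^γ`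
  (`γ < 3/2`)

  implies `ValiantsHypothesis`.

(Q*-poly) is implied by (Q*-mult) of `SoloInformedMultivariateWindow` (polynomials are algebraic
functions) and is a statement about polynomial identities `x^S = ∑ λ_{jk} y_j y_k` in a unique
factorisation domain.  Only the implications are claimed; (Q*-poly) is OPEN (seat notes
`paper/quadspan.md` §2.10).  Monomial sections show the bound fails for every fixed order `K ≤ 5`
(`C₄`-free sum graphs, `m ≍ s^{3/2}`) and give `m ≍ s^{1+1/⌊K/2⌋}` in general.

References: R. Raz, Elusive functions and lower bounds for arithmetic circuits, Theory of
Computing 6 (2010) 135–177, Cor. 5.8 [Raz2010].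
-/

noncomputable section

open MvPolynomial Finset

namespace Summit.ValiantsHypothesis.ValiantsHypothesis.Theorems

open Literature.Computability.AlgebraicComplexity

/-! ### (Q*-poly) implies the summit -/

/-- **Polynomial window form on few variables, exponent version.**  Let `Kf : ℕ → ℕ` with
`Kf s ≤ (⌊log₂ s⌋ + 2)^C` for `s ≥ s₁`, and fix any `c₀`.  If for all `s ≥ s₀`, every set family
`S` of `m` subsets of `Fin n` with `n^{c₀} ≤ s` that is independent to order `Kf s` and realised in
the quadratic span of `s` POLYNOMIALS of `ℂ[x_1, …, x_n]` satisfies `m^b ≤ c · s^a`, where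
`2a < 3b`, then `VP ℂ ≠ VNP ℂ`.  Designs and parameters: the Reed–Muller window designs of
`SoloInformedWindowDesign`; the proof is that of
`soloInformed_vp_ne_vnp_of_multWindowBound_exponent` with polynomial sections.
[cite: Raz2010, Cor. 5.8 (p. 172), Prop. 2.7 (pp. 152–153), Defs. 1.1, 1.3] -/
theorem soloInformed_vp_ne_vnp_of_polyWindowBound_fewVars_exponent (Kf : ℕ → ℕ)
    {Cexp s₁ : ℕ} (hKf : ∀ s, s₁ ≤ s → Kf s ≤ (Nat.log 2 s + 2) ^ Cexp) (c₀ : ℕ)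
    {a b c s₀ : ℕ} (hab : 2 * a < 3 * b)
    (hQ : ∀ s : ℕ, s₀ ≤ s → ∀ (n m : ℕ) (S : Fin m → Finset (Fin n)), n ^ c₀ ≤ s →
      SoloIndep (Kf s) S → ∀ y : Fin s → MvPolynomial (Fin n) ℂ, SoloPolyRealisedFamily y S →
        m ^ b ≤ c * s ^ a) :
    VP ℂ ≠ VNP ℂ := by
  obtain ⟨n₀, hn₀⟩ := qw_eventually a b c Kf hKf
  refine soloInformed_vp_ne_vnp_of_polyWindow_pointwise (r := qwR a b c Kf) (s := qwS a b c)
    (fun n => (qwDesign a b c Kf (fun _ => 1) n).S) ?_ ?_ ?_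
    (qw_isPolyDefinableMap a b c Kf fun _ => 1)
  · refine ⟨n₀, fun n hn => ?_⟩ -- Raz's parameter conditions `3 ≤ r ≤ n ≤ s`
    obtain ⟨hn1, hf, hW⟩ := hn₀ n hn
    have hr : qwR a b c Kf n = 3 * qwRho a b c n := if_pos hf
    have hWge := qwW_ge a b c (qwTau a b c n)
    have hρ : qwRho a b c n = a * qwTau a b c n + 1 := rfl
    refine ⟨?_, ?_, ?_⟩
    · rw [hr, hρ]; omega
    · rw [hr, hρ]; exact hWge.2.1.trans (hW.trans (Nat.log_le_self 2 n))
    · exact Nat.le_self_pow (by rw [hρ]; omega) n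
  · intro c₁ -- growth: `n^{c₁} · C(n + 2ρ - 1, 2ρ) ≤ n^{c₁ + 2ρ} ≤ n^{2ρ + τ} = s`
    refine ⟨max n₀ (2 ^ qwW a b c c₁), fun n hn => ?_⟩
    obtain ⟨hn1, hf, -⟩ := hn₀ n ((le_max_left _ _).trans hn)
    have hr : qwR a b c Kf n = 3 * qwRho a b c n := if_pos hf
    have hτ : c₁ ≤ qwTau a b c n :=
      le_qwTau a b c (Nat.le_log_of_pow_le one_lt_two ((le_max_right _ _).trans hn))
    rw [hr, show 2 * (3 * qwRho a b c n) / 3 = 2 * qwRho a b c n by omega]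
    unfold qwS
    calc n ^ c₁ * Nat.choose (n + 2 * qwRho a b c n - 1) (2 * qwRho a b c n)
        ≤ n ^ c₁ * n ^ (2 * qwRho a b c n) :=
          Nat.mul_le_mul_left _ (choose_multiset_le_pow hn1 _)
      _ = n ^ (c₁ + 2 * qwRho a b c n) := (pow_add _ _ _).symm
      _ ≤ n ^ (2 * qwRho a b c n + qwTau a b c n) := Nat.pow_le_pow_right hn1 (by omega)
  · -- the bound beats the arity; the design lives on `n ≤ s^{1/c₀}` variables once `τ ≥ c₀`
    refine ⟨max (max n₀ s₀) (2 ^ qwW a b c c₀), fun n hn y hreal => ?_⟩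
    have hn' : max n₀ s₀ ≤ n := (le_max_left _ _).trans hn
    obtain ⟨hn1, hf, hW⟩ := hn₀ n ((le_max_left _ _).trans hn')
    have hr : qwR a b c Kf n = 3 * qwRho a b c n := if_pos hf
    have hWge := qwW_ge a b c (qwTau a b c n)
    have hlog : Nat.log 2 n < n := Nat.log_lt_self 2 (by omega)
    have hs₀ : s₀ ≤ qwS a b c n :=
      ((le_max_right _ _).trans hn').trans (Nat.le_self_pow (by unfold qwRho; omega) n)
    have hτc : c₀ ≤ qwTau a b c n :=
      le_qwTau a b c (Nat.le_log_of_pow_le one_lt_two ((le_max_right _ _).trans hn))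
    have hnc : n ^ c₀ ≤ qwS a b c n := by
      unfold qwS
      exact Nat.pow_le_pow_right hn1 (by omega)
    have hQ' := hQ _ hs₀ n _ (qwDesign a b c Kf (fun _ => 1) n).S hnc
      (qwDesign_soloIndep a b c Kf (fun _ => 1) n) y hreal
    rw [hr] at hQ'
    unfold qwS qwRho at hQ'
    set τ := qwTau a b c n with hτdef
    obtain ⟨d₁, hd₁⟩ : ∃ d₁, 3 * b = 2 * a + 1 + d₁ := ⟨3 * b - (2 * a + 1), by omega⟩
    have hident : (2 * (a * τ + 1) + τ) * a + (a * τ * d₁ + d₁ + 1) = 3 * (a * τ + 1) * b := by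
      rw [show 3 * (a * τ + 1) * b = (a * τ + 1) * (3 * b) by ring, hd₁]; ring
    have h1 : n ^ (3 * (a * τ + 1)) ≤
        Nat.factorial (3 * (a * τ + 1)) * Nat.choose (n + 3 * (a * τ + 1) - 1) (3 * (a * τ + 1)) :=
      solo_pow_le_factorial_mul_choose_multiset n _
    have h2 : n ^ (3 * (a * τ + 1) * b) ≤
        Nat.factorial (3 * (a * τ + 1)) ^ b * (c * (n ^ (2 * (a * τ + 1) + τ)) ^ a) :=
      calc n ^ (3 * (a * τ + 1) * b) = (n ^ (3 * (a * τ + 1))) ^ b := pow_mul _ _ _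
        _ ≤ (Nat.factorial (3 * (a * τ + 1)) *
              Nat.choose (n + 3 * (a * τ + 1) - 1) (3 * (a * τ + 1))) ^ b :=
            Nat.pow_le_pow_left h1 _
        _ = Nat.factorial (3 * (a * τ + 1)) ^ b *
              Nat.choose (n + 3 * (a * τ + 1) - 1) (3 * (a * τ + 1)) ^ b := mul_pow _ _ _
        _ ≤ Nat.factorial (3 * (a * τ + 1)) ^ b * (c * (n ^ (2 * (a * τ + 1) + τ)) ^ a) :=
            Nat.mul_le_mul_left _ hQ'
    have h3 : n ^ ((2 * (a * τ + 1) + τ) * a) * n ≤ n ^ (3 * (a * τ + 1) * b) := by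
      rw [← hident, pow_add]; exact Nat.mul_le_mul_left _ (Nat.le_self_pow (by omega) n)
    have h4 : n ^ ((2 * (a * τ + 1) + τ) * a) * n ≤
        n ^ ((2 * (a * τ + 1) + τ) * a) * (Nat.factorial (3 * (a * τ + 1)) ^ b * c) :=
      calc n ^ ((2 * (a * τ + 1) + τ) * a) * n ≤ n ^ (3 * (a * τ + 1) * b) := h3
        _ ≤ Nat.factorial (3 * (a * τ + 1)) ^ b * (c * (n ^ (2 * (a * τ + 1) + τ)) ^ a) := h2
        _ = n ^ ((2 * (a * τ + 1) + τ) * a) * (Nat.factorial (3 * (a * τ + 1)) ^ b * c) := by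
            rw [← pow_mul]; ring
    have h5 : n ≤ Nat.factorial (3 * (a * τ + 1)) ^ b * c :=
      Nat.le_of_mul_le_mul_left h4 (by positivity)
    have h6 : c * Nat.factorial (3 * (a * τ + 1)) ^ b < n :=
      lt_of_le_of_lt (hWge.2.2.2.trans hW) hlog
    linarith [h5, h6]

/-- **Real exponent to natural exponents.**  For `γ < 3/2` and any `C` there are naturals `a, b, c`
with `2a < 3b` such that `m ≤ C · s^γ` (reals, `s ≥ 1`) implies `m^b ≤ c · s^a` (naturals). -/
theorem soloPoly_rpow_to_exponent {γ C : ℝ} (hγ : γ < 3 / 2) :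
    ∃ a b c : ℕ, 2 * a < 3 * b ∧
      ∀ s m : ℕ, 1 ≤ s → (m : ℝ) ≤ C * (s : ℝ) ^ γ → m ^ b ≤ c * s ^ a := by
  set γ' := max γ 0 with hγ'
  have hγ'0 : 0 ≤ γ' := le_max_right _ _
  have hγ'lt : γ' < 3 / 2 := max_lt hγ (by norm_num)
  have hpos : 0 < 3 - 2 * γ' := by linarith
  obtain ⟨b, hb⟩ := exists_nat_gt (2 / (3 - 2 * γ'))
  have hb2 : 2 < (b : ℝ) * (3 - 2 * γ') := (div_lt_iff₀ hpos).1 hb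
  have hb0r : (0 : ℝ) < b := lt_trans (by positivity) hb
  set a := ⌈γ' * b⌉₊ with ha
  have ha1 : γ' * b ≤ a := Nat.le_ceil _
  have ha2 : (a : ℝ) < γ' * b + 1 := Nat.ceil_lt_add_one (by positivity)
  have hab : 2 * a < 3 * b := by exact_mod_cast (by linarith : (2 * a : ℝ) < 3 * b)
  set C' := max C 0 with hC'
  have hC'0 : 0 ≤ C' := le_max_right _ _
  refine ⟨a, b, ⌈C' ^ b⌉₊, hab, fun s m hs hm => ?_⟩
  have hs1 : (1 : ℝ) ≤ s := by exact_mod_cast hs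
  have hs0 : (0 : ℝ) ≤ s := by positivity
  have hγab : γ ≤ (a : ℝ) / b :=
    calc γ ≤ γ' := le_max_left _ _
      _ ≤ (a : ℝ) / b := by rw [le_div_iff₀ hb0r]; exact ha1
  have h1 : (m : ℝ) ≤ C' * (s : ℝ) ^ ((a : ℝ) / b) :=
    calc (m : ℝ) ≤ C * (s : ℝ) ^ γ := hm
      _ ≤ C' * (s : ℝ) ^ γ := mul_le_mul_of_nonneg_right (le_max_left _ _) (by positivity)
      _ ≤ C' * (s : ℝ) ^ ((a : ℝ) / b) :=
          mul_le_mul_of_nonneg_left (Real.rpow_le_rpow_of_exponent_le hs1 hγab) hC'0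
  have h2 : ((m : ℝ)) ^ b ≤ C' ^ b * (s : ℝ) ^ a :=
    calc ((m : ℝ)) ^ b ≤ (C' * (s : ℝ) ^ ((a : ℝ) / b)) ^ b :=
          pow_le_pow_left₀ (by positivity) h1 b
      _ = C' ^ b * ((s : ℝ) ^ ((a : ℝ) / b)) ^ b := mul_pow _ _ _
      _ = C' ^ b * (s : ℝ) ^ a := by
          congr 1
          rw [← Real.rpow_natCast ((s : ℝ) ^ ((a : ℝ) / b)) b, ← Real.rpow_mul hs0,
            div_mul_cancel₀ (a : ℝ) hb0r.ne', Real.rpow_natCast]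
  have h3 : ((m ^ b : ℕ) : ℝ) ≤ ((⌈C' ^ b⌉₊ * s ^ a : ℕ) : ℝ) := by
    push_cast
    calc ((m : ℝ)) ^ b ≤ C' ^ b * (s : ℝ) ^ a := h2
      _ ≤ (⌈C' ^ b⌉₊ : ℝ) * (s : ℝ) ^ a :=
          mul_le_mul_of_nonneg_right (Nat.le_ceil _) (by positivity)
  exact_mod_cast h3

/-- **(Q*-poly on few variables) ⟹ Valiant's hypothesis.**  Fix any `c₀` and any order function
`Kf s ≤ (⌊log₂ s⌋ + 2)^C` (eventually).  If for all large `s`, every set family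
`S_1, …, S_m ⊂ Fin n` with `n^{c₀} ≤ s` that is independent to order `Kf s` and whose monomials
`x^{S_i}` all lie in the linear span of the pairwise products of some `s` POLYNOMIALS
`y_1, …, y_s ∈ ℂ[x_1, …, x_n]` has `m ≤ C' · s^γ` for a real `γ < 3/2`, then `ValiantsHypothesis`.
The hypothesis is OPEN; only the implication is claimed.  This weakens the hypothesis of
`soloInformed_valiantsHypothesis_of_multWindowBound` (algebraic sections) to polynomial sections.
[cite: Raz2010, Cor. 5.8 (p. 172), Prop. 2.7 (pp. 152–153)] -/
theorem soloInformed_valiantsHypothesis_of_polyWindowBound_fewVars (Kf : ℕ → ℕ)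
    {Cexp s₁ : ℕ} (hKf : ∀ s, s₁ ≤ s → Kf s ≤ (Nat.log 2 s + 2) ^ Cexp) (c₀ : ℕ)
    {γ C : ℝ} (hγ : γ < 3 / 2) {s₀ : ℕ}
    (hQ : ∀ s : ℕ, s₀ ≤ s → ∀ (n m : ℕ) (S : Fin m → Finset (Fin n)), n ^ c₀ ≤ s →
      SoloIndep (Kf s) S → ∀ y : Fin s → MvPolynomial (Fin n) ℂ, SoloPolyRealisedFamily y S →
        (m : ℝ) ≤ C * (s : ℝ) ^ γ) :
    ValiantsHypothesis := by
  obtain ⟨a, b, c, hab, hconv⟩ := soloPoly_rpow_to_exponent (C := C) hγ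
  refine soloInformed_vp_ne_vnp_of_polyWindowBound_fewVars_exponent Kf hKf c₀ (a := a) (b := b)
    (c := c) (s₀ := max s₀ 1) hab fun s hs n m S hn hind y hreal => ?_
  exact hconv s m ((le_max_right _ _).trans hs)
    (hQ s ((le_max_left _ _).trans hs) n m S hn hind y hreal)

/-- **(Q*-poly) ⟹ Valiant's hypothesis**, all numbers of variables.  As
`soloInformed_valiantsHypothesis_of_polyWindowBound_fewVars` without the restriction `n^{c₀} ≤ s`.
[cite: Raz2010, Cor. 5.8 (p. 172), Prop. 2.7 (pp. 152–153)] -/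
theorem soloInformed_valiantsHypothesis_of_polyWindowBound (Kf : ℕ → ℕ)
    {Cexp s₁ : ℕ} (hKf : ∀ s, s₁ ≤ s → Kf s ≤ (Nat.log 2 s + 2) ^ Cexp)
    {γ C : ℝ} (hγ : γ < 3 / 2) {s₀ : ℕ}
    (hQ : ∀ s : ℕ, s₀ ≤ s → ∀ (n m : ℕ) (S : Fin m → Finset (Fin n)), SoloIndep (Kf s) S →
      ∀ y : Fin s → MvPolynomial (Fin n) ℂ, SoloPolyRealisedFamily y S →
        (m : ℝ) ≤ C * (s : ℝ) ^ γ) :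
    ValiantsHypothesis :=
  soloInformed_valiantsHypothesis_of_polyWindowBound_fewVars Kf hKf 0 hγ
    fun s hs n m S _ hind y hreal => hQ s hs n m S hind y hreal

/-- **(VB-log-poly on few variables) ⟹ Valiant's hypothesis.**  For any fixed `c₀`: if for some
real `γ < 3/2` and `C`, for all large `s`, every set family `S_1, …, S_m` of subsets of `Fin n` with
`n^{c₀} ≤ s`, whose indicator vectors satisfy no nontrivial integer relation with at most
`⌊log₂ s⌋ + 2` terms, and whose monomials `x^{S_i}` lie in the span of the pairwise products of `s`
polynomials of `ℂ[x_1, …, x_n]`, has `m ≤ C · s^γ`, then `VP ℂ ≠ VNP ℂ`.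
[cite: Raz2010, Cor. 5.8 (p. 172), Prop. 2.7 (pp. 152–153)] -/
theorem soloInformed_valiantsHypothesis_of_polyLogOrderBound_fewVars (c₀ : ℕ) {γ C : ℝ}
    (hγ : γ < 3 / 2) {s₀ : ℕ}
    (hQ : ∀ s : ℕ, s₀ ≤ s → ∀ (n m : ℕ) (S : Fin m → Finset (Fin n)), n ^ c₀ ≤ s →
      SoloIndep (Nat.log 2 s + 2) S → ∀ y : Fin s → MvPolynomial (Fin n) ℂ,
        SoloPolyRealisedFamily y S → (m : ℝ) ≤ C * (s : ℝ) ^ γ) :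
    ValiantsHypothesis :=
  soloInformed_valiantsHypothesis_of_polyWindowBound_fewVars (fun s => Nat.log 2 s + 2) (Cexp := 1)
    (s₁ := 0) (fun s _ => by rw [pow_one]) c₀ hγ hQ

/-- **(VB-log-poly) ⟹ Valiant's hypothesis**, all numbers of variables.
[cite: Raz2010, Cor. 5.8 (p. 172), Prop. 2.7 (pp. 152–153)] -/
theorem soloInformed_valiantsHypothesis_of_polyLogOrderBound {γ C : ℝ} (hγ : γ < 3 / 2) {s₀ : ℕ}
    (hQ : ∀ s : ℕ, s₀ ≤ s → ∀ (n m : ℕ) (S : Fin m → Finset (Fin n)),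
      SoloIndep (Nat.log 2 s + 2) S → ∀ y : Fin s → MvPolynomial (Fin n) ℂ,
        SoloPolyRealisedFamily y S → (m : ℝ) ≤ C * (s : ℝ) ^ γ) :
    ValiantsHypothesis :=
  soloInformed_valiantsHypothesis_of_polyLogOrderBound_fewVars 0 hγ
    fun s hs n m S _ hind y hreal => hQ s hs n m S hind y hreal

/-- **Fixed-order polynomial form on few variables ⟹ Valiant's hypothesis.**  For any fixed `K`
and `c₀`: a bound `m ≤ C · s^γ`, `γ < 3/2`, for all large `s` and all set families on `Fin n`,
`n^{c₀} ≤ s`, that are independent to order `K` and realised in the span of the pairwise products of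
`s` polynomials, gives `VP ℂ ≠ VNP ℂ`.
[cite: Raz2010, Cor. 5.8 (p. 172), Prop. 2.7 (pp. 152–153)] -/
theorem soloInformed_valiantsHypothesis_of_polyFixedOrderBound_fewVars (K c₀ : ℕ) {γ C : ℝ}
    (hγ : γ < 3 / 2) {s₀ : ℕ}
    (hQ : ∀ s : ℕ, s₀ ≤ s → ∀ (n m : ℕ) (S : Fin m → Finset (Fin n)), n ^ c₀ ≤ s →
      SoloIndep K S → ∀ y : Fin s → MvPolynomial (Fin n) ℂ,
        SoloPolyRealisedFamily y S → (m : ℝ) ≤ C * (s : ℝ) ^ γ) :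
    ValiantsHypothesis := by
  refine soloInformed_valiantsHypothesis_of_polyWindowBound_fewVars (fun _ => K) (Cexp := K)
    (s₁ := 0) (fun s _ => ?_) c₀ hγ hQ
  calc K ≤ 2 ^ K := Nat.lt_two_pow_self.le
    _ ≤ (Nat.log 2 s + 2) ^ K := Nat.pow_le_pow_left (by omega) K

/-- **Fixed-order polynomial form ⟹ Valiant's hypothesis**, all numbers of variables.
[cite: Raz2010, Cor. 5.8 (p. 172), Prop. 2.7 (pp. 152–153)] -/
theorem soloInformed_valiantsHypothesis_of_polyFixedOrderBound (K : ℕ) {γ C : ℝ} (hγ : γ < 3 / 2)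
    {s₀ : ℕ}
    (hQ : ∀ s : ℕ, s₀ ≤ s → ∀ (n m : ℕ) (S : Fin m → Finset (Fin n)),
      SoloIndep K S → ∀ y : Fin s → MvPolynomial (Fin n) ℂ,
        SoloPolyRealisedFamily y S → (m : ℝ) ≤ C * (s : ℝ) ^ γ) :
    ValiantsHypothesis :=
  soloInformed_valiantsHypothesis_of_polyFixedOrderBound_fewVars K 0 hγ
    fun s hs n m S _ hind y hreal => hQ s hs n m S hind y hreal

end Summit.ValiantsHypothesis.ValiantsHypothesis.Theorems

end
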